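import Summits.AtomisticToContinuum.HydrodynamicLimit.Theorems.JParityClosureLocalSecondLawKineticStressAlgebra
import Summits.AtomisticToContinuum.HydrodynamicLimit.Theorems.JParityClosureLocalSecondLawCoarseFieldBounds
import Summits.AtomisticToContinuum.HydrodynamicLimit.Theorems.JParityClosureLocalSecondLawLedgerKernel
import Summits.AtomisticToContinuum.HydrodynamicLimit.Theorems.LocalSecondLaw.Negative.Saturation
import Summits.AtomisticToContinuum.HydrodynamicLimit.Theorems.InformationPercolationEngineChaosClosesEulerReadoutEvents
import HarnessLib

/-!
# Kinetic reduction (crux `ChaosClosesEuler`, stmt-AtomisticToContinuum-15141, line `Sketch`,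
# stub `stub_kineticReduction`) — helper: the cone-mollified field of one configuration

WHAT. The field fed to the BF18 shell is `V(s, x) = (ρ_r, m_r, e_r)(Φₛz)(x)`, the `r`-cone-mollified empirical
density, momentum and kinetic energy of one configuration (`rhoC`, `momC`, `kinC` of
`Theorems/LocalSecondLaw/Negative/Functional.lean`). This file collects its algebra and a-priori bounds:
vanishing of every cone field on the empty cone `{ρ_r = 0}` (so Lean's junk values of `m⊗m/ρ`, `θ_r` are harmless);
admissibility `‖m_r‖² ≤ 2ρ_r e_r`; the split of the second moment `M = P + m⊗m/ρ_r` with the CENTRAL tensor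
`P = Σ^dev + ρ_rθ_r 𝟙`, its trace `tr P = 3ρ_rθ_r` and the bounds `|P_{jk}| ≤ 5ρ_rθ_r ≤ (10/3)e_r`,
`∑|mᵢmⱼ|/ρ_r ≤ 6e_r`; the pressure of the band-extension law `p_V = ρ_rθ_r χ(ρ_r)` against `hsPressure`; the
`x`-integrals `∫ρ_r = 1`, `∫‖m_r‖ ≤ ½ + ke`, `∫e_r = ke`; joint measurability in `(s, x)` along a measurable curve of
configurations and the `r`-dependent sup bounds (the shell only asks for SOME bound).

No named fact is invoked.
-/

noncomputable section

namespace Summit.AtomisticToContinuum.HydrodynamicLimit.Theorems.ChaosClosesEulerReduction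

open scoped BigOperators Topology Classical MeasureTheory ENNReal InnerProductSpace
open Filter Set MeasureTheory Function
open Literature.MathematicalPhysics.KineticTheory
open Literature.Analysis.FluidPDE
open Literature.Analysis.FunctionSpaces
open Summit.AtomisticToContinuum.HydrodynamicLimit.Theorems.LocalSecondLawNegative
open Summit.AtomisticToContinuum.HydrodynamicLimit.Theorems.LocalSecondLawLedger
open Summit.AtomisticToContinuum.HydrodynamicLimit.Theorems.LocalSecondLawLedger.L
  (Mmom rhoC_eq_sum momC_apply_eq_sum momC_eq_sum kinC_eq_trace devC_eq uC_apply Mmom_symm norm_sq_eq_sum)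

variable {N : ℕ}

/-! ## §1 The empty cone -/

/-- On the empty cone every cone weight vanishes, hence so does the mollified momentum. [folklore] -/
theorem momC_eq_zero_of_rhoC {r : ℝ} (hr : 0 < r) {w : Phase N} {x : T3} (h : rhoC r w x = 0) : momC r w x = 0 := by
  rw [momC_eq_sum]
  have : ∑ i : Fin (N + 1), cone r (w i).1 x • (w i).2 = 0 :=
    Finset.sum_eq_zero fun i _ => by rw [psvK_cone_eq_zero_of_rhoC_eq_zero hr h i, zero_smul]
  rw [this, smul_zero]

/-- On the empty cone the mollified kinetic energy vanishes. [folklore] -/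
theorem kinC_eq_zero_of_rhoC {r : ℝ} (hr : 0 < r) {w : Phase N} {x : T3} (h : rhoC r w x = 0) : kinC r w x = 0 := by
  rw [kinC_eq_sum]
  have : ∑ i : Fin (N + 1), cone r (w i).1 x * (‖(w i).2‖ ^ 2 / 2) = 0 :=
    Finset.sum_eq_zero fun i _ => by rw [psvK_cone_eq_zero_of_rhoC_eq_zero hr h i, zero_mul]
  rw [this, mul_zero]

/-- On the empty cone the second moments vanish. [folklore] -/
theorem Mmom_eq_zero_of_rhoC {r : ℝ} (hr : 0 < r) {w : Phase N} {x : T3} (h : rhoC r w x = 0) (j k : Fin 3) :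
    Mmom r w x j k = 0 := by
  unfold Mmom
  have : ∑ i : Fin (N + 1), cone r (w i).1 x * ((w i).2 j * (w i).2 k) = 0 :=
    Finset.sum_eq_zero fun i _ => by rw [psvK_cone_eq_zero_of_rhoC_eq_zero hr h i, zero_mul]
  rw [this, mul_zero]

/-- On the empty cone the coarse temperature is `0` (Lean's junk value of the quotient). [folklore] -/
theorem thetaC_eq_zero_of_rhoC {r : ℝ} {w : Phase N} {x : T3} (h : rhoC r w x = 0) : thetaC r w x = 0 := by
  unfold thetaC; rw [h]; simp

/-! ## §2 Admissibility, the central tensor and its trace -/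

/-- **Admissibility of the cone field**: `‖m_r‖² ≤ 2 ρ_r e_r` (Cauchy–Schwarz inside the cone sum, in the form
`ρ_rθ_r ≥ 0`). [folklore] -/
theorem norm_momC_sq_le {r : ℝ} (hr : 0 < r) (w : Phase N) (x : T3) :
    ‖momC r w x‖ ^ 2 ≤ 2 * rhoC r w x * kinC r w x := by
  by_cases h : rhoC r w x = 0
  · rw [momC_eq_zero_of_rhoC hr h, h]; simp
  · have hρ : 0 < rhoC r w x := lt_of_le_of_ne (rhoC_nonneg hr w x) (Ne.symm h)
    have h1 := psvK_rhoC_mul_thetaC_nonneg hr w x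
    rw [psvK_rhoC_mul_thetaC h] at h1
    have h2 : 0 ≤ kinC r w x - ‖momC r w x‖ ^ 2 / (2 * rhoC r w x) := by linarith
    have h3 : ‖momC r w x‖ ^ 2 / (2 * rhoC r w x) ≤ kinC r w x := by linarith
    rw [div_le_iff₀ (by positivity)] at h3
    linarith

/-- **The central second moment through the traceless stress**: `M_{jk} − mⱼmₖ/ρ_r = Σ^dev_{jk} + ρ_rθ_r δ_{jk}`
(both sides vanish on the empty cone). [folklore] -/
theorem Pm_eq_devC_add {r : ℝ} (hr : 0 < r) (w : Phase N) (x : T3) (j k : Fin 3) :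
    Mmom r w x j k - momC r w x j * momC r w x k / rhoC r w x =
      devC r w x j k + rhoC r w x * thetaC r w x * (if j = k then 1 else 0) := by
  rw [devC_eq]
  by_cases h : rhoC r w x = 0
  · rw [Mmom_eq_zero_of_rhoC hr h, momC_eq_zero_of_rhoC hr h, h]; simp
  · simp only [uC_apply]
    field_simp
    ring

/-- **The trace of the central tensor is `3ρ_rθ_r`, identically.** [folklore] -/
theorem trace_Pm {r : ℝ} (hr : 0 < r) (w : Phase N) (x : T3) :
    ∑ k : Fin 3, (Mmom r w x k k - momC r w x k * momC r w x k / rhoC r w x) = 3 * (rhoC r w x * thetaC r w x) := by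
  simp_rw [Pm_eq_devC_add hr]
  rw [Finset.sum_add_distrib, devC_trace hr w x, zero_add]
  simp only [Fin.sum_univ_three, if_true, mul_one]
  ring

/-- `|P_{jk}| ≤ 5ρ_rθ_r`. [folklore] -/
theorem abs_Pm_le {r : ℝ} (hr : 0 < r) (w : Phase N) (x : T3) (j k : Fin 3) :
    |Mmom r w x j k - momC r w x j * momC r w x k / rhoC r w x| ≤ 5 * (rhoC r w x * thetaC r w x) := by
  rw [Pm_eq_devC_add hr]
  have h1 := abs_devC_le_rhoC_mul_thetaC hr w x j k
  have h0 := psvK_rhoC_mul_thetaC_nonneg hr w x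
  refine (abs_add_le _ _).trans ?_
  have h2 : |rhoC r w x * thetaC r w x * (if j = k then 1 else 0)| ≤ rhoC r w x * thetaC r w x := by
    split_ifs
    · rw [mul_one, abs_of_nonneg h0]
    · rw [mul_zero, abs_zero]; exact h0
  linarith

/-- `|P_{jk}| ≤ (10/3) e_r`. [folklore] -/
theorem abs_Pm_le_kinC {r : ℝ} (hr : 0 < r) (w : Phase N) (x : T3) (j k : Fin 3) :
    |Mmom r w x j k - momC r w x j * momC r w x k / rhoC r w x| ≤ 10 / 3 * kinC r w x := by
  have h := abs_Pm_le hr w x j k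
  have h' := psvK_rhoC_mul_thetaC_le hr w x
  linarith

/-- `∑ⱼₖ |P_{jk}| ≤ 30 e_r`. [folklore] -/
theorem sum_abs_Pm_le {r : ℝ} (hr : 0 < r) (w : Phase N) (x : T3) :
    ∑ j : Fin 3, ∑ k : Fin 3, |Mmom r w x j k - momC r w x j * momC r w x k / rhoC r w x| ≤ 30 * kinC r w x := by
  calc _ ≤ ∑ _j : Fin 3, ∑ _k : Fin 3, 10 / 3 * kinC r w x :=
        Finset.sum_le_sum fun j _ => Finset.sum_le_sum fun k _ => abs_Pm_le_kinC hr w x j k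
    _ = 30 * kinC r w x := by simp [Finset.sum_const, Finset.card_univ]; ring

/-- `∑ᵢⱼ |mᵢmⱼ|/ρ_r ≤ 6 e_r` (and `= 0` on the empty cone). [folklore] -/
theorem sum_abs_mm_div_le {r : ℝ} (hr : 0 < r) (w : Phase N) (x : T3) :
    ∑ i : Fin 3, ∑ j : Fin 3, |momC r w x i * momC r w x j / rhoC r w x| ≤ 6 * kinC r w x := by
  by_cases h : rhoC r w x = 0
  · have h0 : ∑ i : Fin 3, ∑ j : Fin 3, |momC r w x i * momC r w x j / rhoC r w x| = 0 := by
      rw [momC_eq_zero_of_rhoC hr h, h]; simp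
    rw [h0]; linarith [kinC_nonneg hr w x]
  · have hρ : 0 < rhoC r w x := lt_of_le_of_ne (rhoC_nonneg hr w x) (Ne.symm h)
    have hcs := norm_momC_sq_le hr w x
    have hsq : (∑ i : Fin 3, |momC r w x i|) ^ 2 ≤ 3 * ‖momC r w x‖ ^ 2 := by
      rw [norm_sq_eq_sum, Fin.sum_univ_three, Fin.sum_univ_three, ← sq_abs (momC r w x 0), ← sq_abs (momC r w x 1),
        ← sq_abs (momC r w x 2)]
      nlinarith [sq_nonneg (|momC r w x 0| - |momC r w x 1|), sq_nonneg (|momC r w x 1| - |momC r w x 2|),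
        sq_nonneg (|momC r w x 0| - |momC r w x 2|)]
    have heq : ∑ i : Fin 3, ∑ j : Fin 3, |momC r w x i * momC r w x j / rhoC r w x| =
        (∑ i : Fin 3, |momC r w x i|) ^ 2 / rhoC r w x := by
      rw [sq, Finset.sum_mul_sum, Finset.sum_div]
      refine Finset.sum_congr rfl fun i _ => ?_
      rw [Finset.sum_div]
      refine Finset.sum_congr rfl fun j _ => ?_
      rw [abs_div, abs_mul, abs_of_pos hρ]
    rw [heq, div_le_iff₀ hρ]
    linarith [hsq, hcs]

/-! ## §3 The pressure of the band-extension law -/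

/-- The coarse temperature of the shell is `thetaC` (definitionally the same formula). [folklore] -/
theorem thetaShell_eq (r : ℝ) (w : Phase N) (x : T3) :
    2 / 3 * (kinC r w x / rhoC r w x - ‖momC r w x‖ ^ 2 / (2 * rhoC r w x ^ 2)) = thetaC r w x := rfl

/-- **The band-extension pressure is the hard-sphere pressure on the band**: if `χ ρ_r = Z(ρ_rσ³)` whenever
`ρ_r > 0`, then `ρ_rθ_r χ(ρ_r) = hsPressure σ ρ_r θ_r` (both vanish on the empty cone). [folklore] -/
theorem pV_eq_hsPressure {σ r : ℝ} {w : Phase N} {x : T3} {χe : ℝ → ℝ}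
    (hband : 0 < rhoC r w x → χe (rhoC r w x) = hsCompressibility (rhoC r w x * σ ^ 3)) (hr : 0 < r) :
    rhoC r w x * thetaC r w x * χe (rhoC r w x) = hsPressure σ (rhoC r w x) (thetaC r w x) := by
  unfold hsPressure
  by_cases h : rhoC r w x = 0
  · rw [h]; simp
  · rw [hband (lt_of_le_of_ne (rhoC_nonneg hr w x) (Ne.symm h))]

/-- `|ρ_rθ_r χ(ρ_r)| ≤ (2/3) B e_r` when `|χ| ≤ B` on `(0, ∞)`. [folklore] -/
theorem abs_pV_le {r : ℝ} (hr : 0 < r) (w : Phase N) (x : T3) {χe : ℝ → ℝ} {B : ℝ} (hB0 : 0 ≤ B)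
    (hB : ∀ a, 0 < a → |χe a| ≤ B) :
    |rhoC r w x * thetaC r w x * χe (rhoC r w x)| ≤ 2 / 3 * B * kinC r w x := by
  have hk := kinC_nonneg hr w x
  by_cases h : rhoC r w x = 0
  · rw [h]; simp only [zero_mul, abs_zero]; positivity
  · have hρ : 0 < rhoC r w x := lt_of_le_of_ne (rhoC_nonneg hr w x) (Ne.symm h)
    rw [abs_mul, abs_of_nonneg (psvK_rhoC_mul_thetaC_nonneg hr w x)]
    calc rhoC r w x * thetaC r w x * |χe (rhoC r w x)| ≤ 2 / 3 * kinC r w x * B :=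
          mul_le_mul (psvK_rhoC_mul_thetaC_le hr w x) (hB _ hρ) (abs_nonneg _) (by positivity)
      _ = 2 / 3 * B * kinC r w x := by ring

/-- `|p_ex| = |hsPressure − ρ_rθ_r| ≤ (2/3)(B + 1) e_r` when `|Z(ρ_rσ³)| ≤ B` (for `ρ_r > 0`). [folklore] -/
theorem abs_pexC_le {σ r : ℝ} (hr : 0 < r) (w : Phase N) (x : T3) {B : ℝ} (hB0 : 0 ≤ B)
    (hB : 0 < rhoC r w x → |hsCompressibility (rhoC r w x * σ ^ 3)| ≤ B) :
    |pexC σ r w x| ≤ 2 / 3 * (B + 1) * kinC r w x := by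
  unfold pexC hsPressure
  have hk := kinC_nonneg hr w x
  by_cases h : rhoC r w x = 0
  · rw [h]; simp only [zero_mul, sub_zero, abs_zero]; positivity
  · have hρ : 0 < rhoC r w x := lt_of_le_of_ne (rhoC_nonneg hr w x) (Ne.symm h)
    have heq : rhoC r w x * thetaC r w x * hsCompressibility (rhoC r w x * σ ^ 3) - rhoC r w x * thetaC r w x =
        rhoC r w x * thetaC r w x * (hsCompressibility (rhoC r w x * σ ^ 3) - 1) := by ring
    rw [heq, abs_mul, abs_of_nonneg (psvK_rhoC_mul_thetaC_nonneg hr w x)]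
    have h1 : |hsCompressibility (rhoC r w x * σ ^ 3) - 1| ≤ B + 1 :=
      (abs_sub _ _).trans (by rw [abs_one]; linarith [hB hρ])
    calc rhoC r w x * thetaC r w x * |hsCompressibility (rhoC r w x * σ ^ 3) - 1| ≤ 2 / 3 * kinC r w x * (B + 1) :=
          mul_le_mul (psvK_rhoC_mul_thetaC_le hr w x) h1 (abs_nonneg _) (by positivity)
      _ = 2 / 3 * (B + 1) * kinC r w x := by ring

/-! ## §4 Sup bounds and `x`-integrals -/

/-- `ρ_r ≤ 3/(πr³)`. [folklore] -/
theorem rhoC_le {r : ℝ} (hr : 0 < r) (w : Phase N) (x : T3) : rhoC r w x ≤ 3 / (Real.pi * r ^ 3) :=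
  DensityCapNegative.mollDensity_le hr w x

/-- `∫ ‖m_r‖ ≤ ½ + ke`. [folklore] -/
theorem integral_norm_momC_le {r : ℝ} (hr : 0 < r) (hr2 : r < 1 / 2) (w : Phase N) :
    ∫ x, ‖momC r w x‖ ≤ 1 / 2 + ke w := by
  have hpt : ∀ x, ‖momC r w x‖ ≤ ((N + 1 : ℕ) : ℝ)⁻¹ * ∑ i, cone r (w i).1 x * ‖(w i).2‖ := by
    intro x
    rw [momC_eq_sum, norm_smul, Real.norm_eq_abs, abs_of_nonneg (by positivity)]
    refine mul_le_mul_of_nonneg_left ((norm_sum_le _ _).trans (Finset.sum_le_sum fun i _ => ?_)) (by positivity)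
    rw [norm_smul, Real.norm_eq_abs, abs_of_nonneg (cone_nonneg hr _ _)]
  have hci : ∀ i : Fin (N + 1), Integrable (fun x => cone r (w i).1 x * ‖(w i).2‖) volume := fun i =>
    ((continuous_cone r (w i).1).mul continuous_const).integrable_unitAddTorus
  have hint : Integrable (fun x => ((N + 1 : ℕ) : ℝ)⁻¹ * ∑ i, cone r (w i).1 x * ‖(w i).2‖) volume :=
    (integrable_finsetSum _ fun i _ => hci i).const_mul _
  calc ∫ x, ‖momC r w x‖ ≤ ∫ x, ((N + 1 : ℕ) : ℝ)⁻¹ * ∑ i, cone r (w i).1 x * ‖(w i).2‖ :=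
        integral_mono_of_nonneg (ae_of_all _ fun x => norm_nonneg _) hint (ae_of_all _ hpt)
    _ = ((N + 1 : ℕ) : ℝ)⁻¹ * ∑ i, ‖(w i).2‖ := by
        rw [integral_const_mul, integral_finsetSum _ fun i _ => hci i]
        congr 1
        refine Finset.sum_congr rfl fun i _ => ?_
        rw [integral_mul_const]
        have h1 : ∫ x, cone r (w i).1 x = 1 := integral_cone_eq_one hr hr2 (w i).1
        rw [h1, one_mul]
    _ ≤ 1 / 2 + ke w := meanSpeed_le w

/-! ## §5 Along a measurable curve of configurations: measurability -/

section Orbit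

variable {γ : ℝ → Phase N} (hγ : Measurable γ) (r : ℝ)
include hγ

/-- The mollified density read along a measurable curve is jointly measurable in `(s, x)`. [folklore] -/
theorem measurable_rhoC_orbit : Measurable fun p : ℝ × T3 => rhoC r (γ p.1) p.2 := by
  have h := ChaosClosesEulerReadout.measurable_sum_cone_mul hγ r (c := fun _ => (1 : ℝ)) continuous_const
  have heq : (fun p : ℝ × T3 => rhoC r (γ p.1) p.2) =
      fun p => ((N + 1 : ℕ) : ℝ)⁻¹ * ∑ i, DensityCapNegative.cone r (γ p.1 i).1 p.2 * (fun _ : V3 => (1 : ℝ)) (γ p.1 i).2 := by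
    funext p; rw [rhoC_eq_sum]; simp only [mul_one]; rfl
  rw [heq]; exact measurable_const.mul h

/-- The mollified momentum read along a measurable curve is jointly measurable. [folklore] -/
theorem measurable_momC_orbit : Measurable fun p : ℝ × T3 => momC r (γ p.1) p.2 := by
  have h := ChaosClosesEulerReadout.measurable_sum_kernel_smul hγ (ChaosClosesEulerReadout.continuous_uncurry_cone r)
    (c := fun v : V3 => v) continuous_id
  have heq : (fun p : ℝ × T3 => momC r (γ p.1) p.2) =
      fun p => ((N + 1 : ℕ) : ℝ)⁻¹ • ∑ i, DensityCapNegative.cone r (γ p.1 i).1 p.2 • (fun v : V3 => v) (γ p.1 i).2 := by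
    funext p; rw [momC_eq_sum]; rfl
  rw [heq]; exact h.const_smul (((N + 1 : ℕ) : ℝ)⁻¹)

/-- Components of the mollified momentum along a measurable curve are jointly measurable. [folklore] -/
theorem measurable_momC_apply_orbit (k : Fin 3) : Measurable fun p : ℝ × T3 => momC r (γ p.1) p.2 k :=
  (EuclideanSpace.proj k : V3 →L[ℝ] ℝ).continuous.measurable.comp (measurable_momC_orbit hγ r)

/-- The mollified kinetic energy along a measurable curve is jointly measurable. [folklore] -/
theorem measurable_kinC_orbit : Measurable fun p : ℝ × T3 => kinC r (γ p.1) p.2 := by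
  have h := ChaosClosesEulerReadout.measurable_sum_cone_mul hγ r (c := fun v : V3 => ‖v‖ ^ 2 / 2)
    ((continuous_norm.pow 2).div_const 2)
  have heq : (fun p : ℝ × T3 => kinC r (γ p.1) p.2) =
      fun p => ((N + 1 : ℕ) : ℝ)⁻¹ * ∑ i, DensityCapNegative.cone r (γ p.1 i).1 p.2 * (fun v : V3 => ‖v‖ ^ 2 / 2) (γ p.1 i).2 := by
    funext p; rw [kinC_eq_sum]; rfl
  rw [heq]; exact measurable_const.mul h

/-- The second moments along a measurable curve are jointly measurable. [folklore] -/
theorem measurable_Mmom_orbit (j k : Fin 3) : Measurable fun p : ℝ × T3 => Mmom r (γ p.1) p.2 j k := by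
  have hc : Continuous fun v : V3 => v j * v k :=
    ((EuclideanSpace.proj j : V3 →L[ℝ] ℝ).continuous).mul ((EuclideanSpace.proj k : V3 →L[ℝ] ℝ).continuous)
  have h := ChaosClosesEulerReadout.measurable_sum_cone_mul hγ r (c := fun v : V3 => v j * v k) hc
  have heq : (fun p : ℝ × T3 => Mmom r (γ p.1) p.2 j k) =
      fun p => ((N + 1 : ℕ) : ℝ)⁻¹ * ∑ i, DensityCapNegative.cone r (γ p.1 i).1 p.2 * (fun v : V3 => v j * v k) (γ p.1 i).2 := by
    funext p; rfl
  rw [heq]; exact measurable_const.mul h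

/-- The coarse temperature along a measurable curve is jointly measurable. [folklore] -/
theorem measurable_thetaC_orbit : Measurable fun p : ℝ × T3 => thetaC r (γ p.1) p.2 := by
  unfold thetaC
  exact measurable_const.mul (((measurable_kinC_orbit hγ r).div (measurable_rhoC_orbit hγ r)).sub
    (((measurable_momC_orbit hγ r).norm.pow_const 2).div (measurable_const.mul ((measurable_rhoC_orbit hγ r).pow_const 2))))

/-- **The shell's field `V = (ρ_r, m_r, e_r)` along a measurable curve is jointly measurable.** [folklore] -/
theorem measurable_V_orbit : Measurable (uncurry fun s x => (rhoC r (γ s) x, momC r (γ s) x, kinC r (γ s) x)) :=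
  (measurable_rhoC_orbit hγ r).prodMk ((measurable_momC_orbit hγ r).prodMk (measurable_kinC_orbit hγ r))

end Orbit

/-! ## §6 The registered sub-goal -/

/-- **Registered sub-goal `stub_reductionFields` (helper of `stub_kineticReduction`): admissibility of the
cone-mollified field**, `‖m_r‖² ≤ 2 ρ_r e_r` at every centre — the third structural hypothesis of the BF18 shell for
the field `V = (ρ_r, m_r, e_r)`. [folklore] -/
theorem stub_reductionFields : ∀ {N : ℕ} {r : ℝ}, 0 < r → ∀ (w : Config (N + 1) (Fin 3) T3) (x : T3), ‖momC r w x‖ ^ 2 ≤ 2 * rhoC r w x * kinC r w x :=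
  fun hr w x => norm_momC_sq_le hr w x

end Summit.AtomisticToContinuum.HydrodynamicLimit.Theorems.ChaosClosesEulerReduction

end
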